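import Literature.NumberTheory.EllipticCurves.DivisionFieldRamificationProofs
import Literature.NumberTheory.EllipticCurves.TorsionCardinality
import Mathlib.LinearAlgebra.Matrix.GeneralLinearGroup.Card
import HarnessLib

/-!
# Division fields at multiplicative places: the ramification index DIVIDES `p`
# ([IUTchIV] Prop. 1.8 (vii), second sentence, in print's strength at prime level)

`Proofs` file (theorems only: no definition, no named fact), topic `NumberTheory/EllipticCurves`;
companion of `DivisionFieldRamificationProofs` (which proves the weaker "`e(Q ∣ v)` is a power of `p`").

S. Mochizuki, *Inter-universal Teichmüller theory IV*, Prop. 1.8 (vii), kurims p. 19, second sentence: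
"If `E_k` has bad multiplicative reduction over `O_k`, then the kernel of the action of `G_k` on `E_k[n]`
determines a tamely ramified extension of `k` whose ramification index over `k` **divides `n`**"
(classical: Silverman *ATAEC* V.4–V.5, Ex. 5.13 (b); [NerMod] §7.4 Thm. 5).  GLOBAL number-field form,
prime level `n = p`: for `E/K` elliptic over a number field, `p` prime, `L ⊆ K̄` finite Galois over `K`
with `L ⊆ K(E[p])` (`ker ρ̄_{E,p} ≤ Gal(K̄/L)`), `v ∤ p` a place of multiplicative reduction and `Q` any
prime of `𝓞 L` over `v`:

* `WeierstrassCurve.ramificationIdx_divisionField_dvd_of_hasMultiplicativeReductionAt` —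
  **`e(Q ∣ v) ∣ p`**, i.e. `e(Q ∣ v) ∈ {1, p}`.

Route (no Tate curve beyond what the tree already proved): by `DivisionFieldRamificationProofs`,
`e(Q ∣ v) = #I_P(Gal(L/K)) = p^k`; by Lagrange and Galois bookkeeping
`e ∣ #Gal(L/K) = [Γ_K : Gal(K̄/L)] ∣ [Γ_K : ker ρ̄_{E,p}] = #im ρ̄_{E,p} ∣ #Aut(E[p])`; and
`#Aut(E[p]) = #GL₂(𝔽_p) = (p² − 1)(p² − p)` (`E[p] ≅ 𝔽_p²`: the tree's `card_torsionBy_eq_sq`, Mathlib's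
`AddSubgroup.torsionBy.zmodModule`, `Matrix.card_GL_field`), which `p²` does not divide.

Also exported (generic, reusable): `natCard_addAut_eq_natCard_linearEquiv`, `natCard_addAut_eq_of_natCard_eq_sq`
(`#Aut(V) = (p²−1)(p²−p)` for an `𝔽_p`-module of order `p²`), and the Galois step
`natCard_algEquiv_dvd_natCard_of_ker_le_fixingSubgroup` (`#Gal(L/K) ∣ #M` whenever
`ker (Φ : Γ_K →* M) ≤ Gal(K̄/L)`).  Classical algebraic number theory; nothing here bears on
[IUTchIII] Cor. 3.12.

## References

* [SilvermanATAEC1994] J. H. Silverman, *Advanced Topics in the Arithmetic of Elliptic Curves* (1994),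
  V.4–V.5, Exercise 5.13 (b).
* [NeukirchANT1999] J. Neukirch, *Algebraic Number Theory* (1999), Ch. I §9 (9.6), (9.9).
* [Mochizuki2012] S. Mochizuki, *Inter-universal Teichmüller theory IV*, Prop. 1.8 (vii) p. 19.
-/

noncomputable section

open scoped Pointwise IntermediateField NumberField

open NumberField IsDedekindDomain IntermediateField Field

universe u

namespace Literature.NumberTheory.EllipticCurves

/-! ### Arithmetic: `p`-powers dividing `#GL₂(𝔽_p)` -/

/-- If `p` is prime and `p^k ∣ (p² − 1)(p² − p) = #GL₂(𝔽_p)`, then `p^k ∣ p`: the `p`-part of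
`#GL₂(𝔽_p) = p·(p − 1)²(p + 1)` is `p`. [folklore] -/
private theorem pow_dvd_prime_of_pow_dvd_card_GL_two {p k : ℕ} (hp : p.Prime)
    (h : p ^ k ∣ (p ^ 2 - 1) * (p ^ 2 - p)) : p ^ k ∣ p := by
  have hp1 : 1 ≤ p := hp.one_lt.le
  -- `(p² − 1)(p² − p) = p · ((p − 1)(p + 1)(p − 1))`
  have hfac : (p ^ 2 - 1) * (p ^ 2 - p) = p * ((p - 1) * (p + 1) * (p - 1)) := by
    have h1 : p ^ 2 - 1 = (p - 1) * (p + 1) := by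
      rw [mul_comm, ← Nat.sq_sub_sq, one_pow]
    have h2 : p ^ 2 - p = p * (p - 1) := by
      rw [Nat.mul_sub, mul_one, sq]
    rw [h1, h2]; ring
  rw [hfac] at h
  -- `p` is coprime to `(p − 1)(p + 1)(p − 1)`
  have hcop1 : Nat.Coprime p (p - 1) := by
    refine (Nat.Prime.coprime_iff_not_dvd hp).mpr fun hd => ?_
    have hlt : p - 1 < p := Nat.sub_lt hp.pos one_pos
    have hpos : 0 < p - 1 := Nat.sub_pos_of_lt hp.one_lt
    exact absurd (Nat.le_of_dvd hpos hd) (not_le.mpr hlt)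
  have hcop2 : Nat.Coprime p (p + 1) := by
    refine (Nat.Prime.coprime_iff_not_dvd hp).mpr fun hd => ?_
    have : p ∣ 1 := (Nat.dvd_add_right (dvd_refl p)).mp hd
    exact hp.one_lt.ne' (Nat.dvd_one.mp this)
  have hcop : Nat.Coprime (p ^ k) ((p - 1) * (p + 1) * (p - 1)) :=
    Nat.Coprime.pow_left k ((hcop1.mul_right hcop2).mul_right hcop1)
  exact hcop.dvd_of_dvd_mul_right h

/-! ### Linear algebra: `#Aut(V) = (p² − 1)(p² − p)` for an `𝔽_p`-module of order `p²` -/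

section AddAutCard

variable {p : ℕ} [Fact p.Prime] {V : Type u} [AddCommGroup V] [Module (ZMod p) V]

/-- Additive automorphisms of a `ZMod p`-module are in bijection with its `ZMod p`-linear
automorphisms (every additive map is `ZMod p`-linear, Mathlib `ZMod.map_smul`), hence have the same
cardinality (Serre 1972 §4.1: `Aut(E_l) ≅ GL₂(𝔽_l)` once a basis is chosen). [cite: Serre1972, §4.1] -/
theorem natCard_addAut_eq_natCard_linearEquiv :
    Nat.card (AddAut V) = Nat.card (V ≃ₗ[ZMod p] V) :=
  Nat.card_congr
    { toFun := fun e => e.toLinearEquiv (ZMod.map_smul e)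
      invFun := fun l => l.toAddEquiv
      left_inv := fun e => by ext; rfl
      right_inv := fun l => by ext; rfl }

/-- **`#Aut(V) = (p² − 1)(p² − p)`** for an `𝔽_p`-module `V` with `p²` elements (`V ≅ 𝔽_p²`, so
`Aut(V) ≅ GL₂(𝔽_p)`, Serre 1972 §4.1; Mathlib `Matrix.card_GL_field`). [cite: Serre1972, §4.1] -/
theorem natCard_addAut_eq_of_natCard_eq_sq (hV : Nat.card V = p ^ 2) :
    Nat.card (AddAut V) = (p ^ 2 - 1) * (p ^ 2 - p) := by
  have hp : p.Prime := Fact.out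
  haveI : Finite V := Nat.finite_of_card_ne_zero (by rw [hV]; exact pow_ne_zero _ hp.ne_zero)
  haveI : Module.Finite (ZMod p) V := Module.Finite.of_finite
  haveI : Module.Free (ZMod p) V := Module.Free.of_divisionRing _ _
  have hrank : Module.finrank (ZMod p) V = 2 := by
    have h := Module.natCard_eq_pow_finrank (K := ZMod p) (V := V)
    rw [hV, Nat.card_zmod] at h
    exact (Nat.pow_right_injective hp.two_le h).symm
  let b : Module.Basis (Fin 2) (ZMod p) V := Module.finBasisOfFinrankEq (ZMod p) V hrank
  calc Nat.card (AddAut V)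
      = Nat.card (V ≃ₗ[ZMod p] V) := natCard_addAut_eq_natCard_linearEquiv
    _ = Nat.card (LinearMap.GeneralLinearGroup (ZMod p) V) :=
        Nat.card_congr (LinearMap.GeneralLinearGroup.generalLinearEquiv (ZMod p) V).toEquiv.symm
    _ = Nat.card (GL (Fin 2) (ZMod p)) :=
        Nat.card_congr (Matrix.GeneralLinearGroup.toLin' b).toEquiv.symm
    _ = (p ^ 2 - 1) * (p ^ 2 - p) := by
        rw [Matrix.card_GL_field, Fin.prod_univ_two, ZMod.card]
        simp

end AddAutCard

/-! ### Galois bookkeeping: `#Gal(L/K)` divides `#M` when `ker (Γ_K → M)` fixes `L` -/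

section Galois

variable {K : Type u} [Field K]

/-- For a finite Galois subextension `L ⊆ K̄` of `K` and a homomorphism `Φ : Γ_K →* M` whose kernel
fixes `L` pointwise (i.e. `L ⊆` the field cut out by `Φ`), `#Gal(L/K) = [Γ_K : Gal(K̄/L)]` divides
`[Γ_K : ker Φ] = #im Φ`, which divides `#M` (Galois correspondence for `K̄/K`,
Neukirch *ANT* IV §1). [cite: NeukirchANT1999, Ch. IV §1 Thm. (1.1)] -/
theorem natCard_algEquiv_dvd_natCard_of_ker_le_fixingSubgroup
    (L : IntermediateField K (AlgebraicClosure K)) [Normal K L]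
    {M : Type*} [Group M] (Φ : (AlgebraicClosure K ≃ₐ[K] AlgebraicClosure K) →* M)
    (hΦ : Φ.ker ≤ L.fixingSubgroup) :
    Nat.card (L ≃ₐ[K] L) ∣ Nat.card M := by
  -- `#Gal(L/K) = [Γ_K : Gal(K̄/L)]` via the surjection `restrictNormalHom L`
  have h1 : Nat.card (L ≃ₐ[K] L) = L.fixingSubgroup.index := by
    rw [← IntermediateField.restrictNormalHom_ker L, Subgroup.index_ker,
      MonoidHom.range_eq_top.mpr (AlgEquiv.restrictNormalHom_surjective (AlgebraicClosure K)),
      Subgroup.card_top]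
  rw [h1]
  calc L.fixingSubgroup.index ∣ Φ.ker.index := Subgroup.index_dvd_of_le hΦ
    _ = Nat.card Φ.range := Subgroup.index_ker Φ
    _ ∣ Nat.card M := Subgroup.card_subgroup_dvd_card _

end Galois

end Literature.NumberTheory.EllipticCurves

/-! ### Division fields of an elliptic curve at multiplicative places -/

namespace WeierstrassCurve

open Literature.NumberTheory.EllipticCurves IsDedekindDomain.HeightOneSpectrum

variable {K : Type u} [Field K] [NumberField K] (W : WeierstrassCurve K)

/-- `#E[p] = p²` for the geometric `p`-torsion of an elliptic curve over a number field (the tree's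
`card_torsionBy_eq_sq`, Silverman *AEC* III.6.4 (b), read on `geomTorsion`).
[cite: SilvermanAEC2009, Cor. III.6.4(b)] -/
theorem natCard_geomTorsion_prime_eq_sq [W.IsElliptic] {p : ℕ} (hp : p.Prime) :
    Nat.card (W.geomTorsion (p : ℤ)) = p ^ 2 := by
  haveI : (W.baseChange (AlgebraicClosure K)).IsElliptic :=
    inferInstanceAs (W.map (algebraMap K (AlgebraicClosure K))).IsElliptic
  haveI : CharZero (AlgebraicClosure K) :=
    charZero_of_injective_algebraMap (algebraMap K (AlgebraicClosure K)).injective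
  have hpne : ((p : ℕ) : AlgebraicClosure K) ≠ 0 := by exact_mod_cast hp.ne_zero
  exact card_torsionBy_eq_sq (E := W.baseChange (AlgebraicClosure K)) hpne

/-- **`#Aut(E[p]) = (p² − 1)(p² − p)`** (`= #GL₂(𝔽_p)`) for an elliptic curve over a number field
and a prime `p`. [cite: Serre1972, §4.1] -/
theorem natCard_addAut_geomTorsion [W.IsElliptic] {p : ℕ} (hp : p.Prime) :
    Nat.card (AddAut (W.geomTorsion (p : ℤ))) = (p ^ 2 - 1) * (p ^ 2 - p) := by
  haveI : Fact p.Prime := ⟨hp⟩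
  letI : Module (ZMod p) (W.geomTorsion (p : ℤ)) := AddSubgroup.torsionBy.zmodModule
  exact natCard_addAut_eq_of_natCard_eq_sq (W.natCard_geomTorsion_prime_eq_sq hp)

/-- **Division fields at multiplicative places `v ∤ p`: the ramification index DIVIDES `p`**
([IUTchIV] Prop. 1.8 (vii), second sentence, at prime level, in print's strength "divides `n`").
Let `E/K` be elliptic over a number field, `p` prime, `L ⊆ K̄` finite Galois over `K` with
`L ⊆ K(E[p])` (`ker ρ̄_{E,p} ≤ Gal(K̄/L)`), `v ∤ p` a place of multiplicative reduction.  Then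
`e(Q ∣ v) ∣ p` for every prime `Q` of `𝓞 L` over `v` (so `e(Q ∣ v) ∈ {1, p}`): by
`exists_ramificationIdx_divisionField_eq_pow_of_hasMultiplicativeReductionAt`, `e = p^k`; and
`e ∣ #Gal(L/K) ∣ #im ρ̄_{E,p} ∣ #Aut(E[p]) = (p² − 1)(p² − p)`, which `p²` does not divide.
[cite: SilvermanATAEC1994, V.4–V.5 and Exercise 5.13 (b)] [cite: Mochizuki2012, IUTchIV Prop 1.8 (vii) p.19] -/
theorem ramificationIdx_divisionField_dvd_of_hasMultiplicativeReductionAt [W.IsElliptic]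
    {p : ℕ} (hp : p.Prime) (L : IntermediateField K (AlgebraicClosure K)) [FiniteDimensional K L]
    [IsGalois K L] (hL : (W.galoisRepTorsion (p : ℤ)).ker ≤ L.fixingSubgroup)
    {v : HeightOneSpectrum (𝓞 K)} (hv : W.HasMultiplicativeReductionAt v)
    (hpv : (p : 𝓞 K) ∉ v.asIdeal) (Q : Ideal (𝓞 L)) [Q.IsPrime] [Q.LiesOver v.asIdeal] :
    Q.ramificationIdx (𝓞 K) ∣ p := by
  obtain ⟨k, hk⟩ :=
    W.exists_ramificationIdx_divisionField_eq_pow_of_hasMultiplicativeReductionAt hp L hL hv hpv Q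
  -- `e(Q ∣ v) ∣ #Gal(L/K)`: `e` is the order of an inertia subgroup of `Gal(L/K)`
  obtain ⟨𝔓, h𝔓⟩ := HeightOneSpectrum.primesAbove_nonempty v
  have hdvdG : Q.ramificationIdx (𝓞 K) ∣ Nat.card (L ≃ₐ[K] L) := by
    rw [@ramificationIdx_eq_card_inertia_comap K _ _ L _ _ v 𝔓 h𝔓.1 h𝔓.2 Q _ _]
    exact Subgroup.card_subgroup_dvd_card _
  -- `#Gal(L/K) ∣ #Aut(E[p]) = (p² − 1)(p² − p)`
  have hGdvd : Nat.card (L ≃ₐ[K] L) ∣ (p ^ 2 - 1) * (p ^ 2 - p) := by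
    have h := natCard_algEquiv_dvd_natCard_of_ker_le_fixingSubgroup L (W.galoisRepTorsion (p : ℤ)) hL
    rwa [show Nat.card (Multiplicative (AddAut (W.geomTorsion (p : ℤ)))) =
        Nat.card (AddAut (W.geomTorsion (p : ℤ))) from Nat.card_congr Multiplicative.toAdd,
      W.natCard_addAut_geomTorsion hp] at h
  have hpk : p ^ k ∣ (p ^ 2 - 1) * (p ^ 2 - p) := hk ▸ hdvdG.trans hGdvd
  rw [hk]
  exact pow_dvd_prime_of_pow_dvd_card_GL_two hp hpk

/-- Reformulation: under the same hypotheses **`e(Q ∣ v) = 1` or `e(Q ∣ v) = p`**.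
[cite: Mochizuki2012, IUTchIV Prop 1.8 (vii) p.19] -/
theorem ramificationIdx_divisionField_eq_one_or_eq_of_hasMultiplicativeReductionAt [W.IsElliptic]
    {p : ℕ} (hp : p.Prime) (L : IntermediateField K (AlgebraicClosure K)) [FiniteDimensional K L]
    [IsGalois K L] (hL : (W.galoisRepTorsion (p : ℤ)).ker ≤ L.fixingSubgroup)
    {v : HeightOneSpectrum (𝓞 K)} (hv : W.HasMultiplicativeReductionAt v)
    (hpv : (p : 𝓞 K) ∉ v.asIdeal) (Q : Ideal (𝓞 L)) [Q.IsPrime] [Q.LiesOver v.asIdeal] :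
    Q.ramificationIdx (𝓞 K) = 1 ∨ Q.ramificationIdx (𝓞 K) = p :=
  (Nat.dvd_prime hp).mp
    (W.ramificationIdx_divisionField_dvd_of_hasMultiplicativeReductionAt hp L hL hv hpv Q)

end WeierstrassCurve

end
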